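import Summits.RiemannHypothesis.RiemannHypothesis.Theorems.TiltedLandingLaw421R3Lens1CoverageB
import Summits.RiemannHypothesis.RiemannHypothesis.Theorems.TiltedLandingLaw421R3JensenDipQuant

/-! # Lens-1 COVERAGE THEOREM (file C: the QUANTITATIVE landing cell «L-Q» and the v3 compositions)

(CA450)(2) interface, verbatim.  Imports file B (`…R3Lens1CoverageB`: cells, `RegCov8/RegLedge8/RegE8`, `Doors8`, `_of_regimes2`) and the
quantitative Jensen dip (`…R3JensenDipQuant`: `RhW08.Lens1Quant.succ_of_dip_edge`).  Declares `ConeBudget`, `LandingDipQ`, `regime_LQ`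
(PROVED, successor currency), the open residual stub `RegLfar8` (cell L with neither a deep dip nor a quantitative dip ⇒ a Q8 door; strictly
below `RegLedge8`), and the compositions `antiEscapeCore_of_regimes3` / `restSuccBotQ_of_regimes3` / `TiltedLandingLaw421R_of_regimes3`.
0 sorry.  Nothing here bears on the truth of RH; RH is not proved; the crux ⟨33346⟩ stays OPEN (`RegCov8/RegLfar8/RegE8` and lens-2's
`RateLawsHalfQ` are hypotheses of the composition). -/

namespace RhW08.Lens1Coverage

set_option linter.dupNamespace false

open Complex Set
open scoped ComplexConjugate
open Literature.Analysis.Complex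
open Summit.RiemannHypothesis.RiemannHypothesis.Theorems.Splittings.JensenWindow
open RhIdea6.G17.W07C7 RhIdea6.G17.W07C7.Rev6 RhIdea6.G18.W07C8.Law421BirthS RhIdea6.G19.W07C11.Seam
open RhIdea6.G20.W07C12.Frac RhIdea6.G20.W07C12.StColP RhW07.C12.FieldSplit RhIdea6.G21.W07C13.TentMax
open RhW07.C14.TwoSided RhW07.C14.Classes RhW07.C14.Lineage RhW07.C14.Booking
open RhW07.C13.Heredity RhIdea6.G22.W07C15pre.Injection RhW07.E3.Cell RhW07.E3.Lit
open RhW08.Round1 RhW08.StSwap RhW08.Round2 RhW08.QuadW RhW08.SealSwapQ RhW08.SealSwap RhW08.SuccB RhW08.SuccSplit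
open RhW08.SuccTheft RhW08.Column RhW08.Hurwitz RhW08.ClusterQ RhW08.ClusterQM RhW08.NewtonDoor RhW08.NewtonDoorGenusOne RhW08.PurseP
open RhW08.AntiEscapeSplit7

/-! ## §16 The quantitative landing cell «L-Q» -/

/-- CONE MULTIPLICITY BUDGET of `g := f^{(j+1)}` over the real point `xs` (list form, = the hypothesis `hN` of
`RhW08.Lens1Quant.jensenDip_quant`): every list of zeros of `g` in the open Jensen cone `|xs − Re a| < |Im a|` (both half-planes) whose
linear factors jointly divide `g` has length `≤ N`.  A conjugate pair of simple cone zeros gives `N = 2`. -/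
def ConeBudget (f : ℂ → ℂ) (j : ℕ) (xs : ℝ) (N : ℕ) : Prop :=
  ∀ L : List ℂ, (∀ a ∈ L, iteratedDeriv (j + 1) f a = 0 ∧ |xs - a.re| < |a.im|) →
    (∃ q : ℂ → ℂ, Differentiable ℂ q ∧ ∀ z, iteratedDeriv (j + 1) f z = (L.map (fun a => z - a)).prod * q z) →
      L.length ≤ N

/-- CELL DATUM «L-Q» (quantitative landing dip under `v`): the `LandingDip` jets at a real `xs` with `|xs − Re v| < 2·Im v`, a cone budget
`N` at `xs`, and a height `h > 0` clearing the quantitative Jensen threshold `N·|m| < 2·|A|·h²` inside the LATERAL level-`(j+1)` window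
`max(|xs − x₀| + h − R/2, 0)² + (j+1)·h² ≤ (j+1)·Hs²`. -/
def LandingDipQ (f : ℂ → ℂ) (x₀ R Hs : ℝ) (j : ℕ) (v : ℂ) : Prop :=
  ∃ xs m A : ℝ, |xs - v.re| < 2 * v.im ∧ (m : ℂ) = iteratedDeriv (j + 1) f xs ∧ iteratedDeriv (j + 2) f xs = 0 ∧
    ((2 * A : ℝ) : ℂ) = iteratedDeriv (j + 3) f xs ∧ 0 < m * A ∧
    ∃ (N : ℕ) (h : ℝ), ConeBudget f j xs N ∧ 0 < h ∧ (N : ℝ) * |m| < 2 * |A| * h ^ 2 ∧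
      (max (|xs - x₀| + h - R / 2) 0) ^ 2 + ((j : ℝ) + 1) * h ^ 2 ≤ ((j : ℝ) + 1) * Hs ^ 2

/-- A quantitative landing dip is a landing dip (drop the budget/height data). -/
theorem landingDip_of_Q {f : ℂ → ℂ} {x₀ R Hs : ℝ} {j : ℕ} {v : ℂ} (h : LandingDipQ f x₀ R Hs j v) : LandingDip f j v := by
  obtain ⟨xs, m, A, h1, h2, h3, h4, h5, -⟩ := h
  exact ⟨xs, m, A, h1, h2, h3, h4, h5⟩

/-- ★ REGIME LEMMA «L-Q» (PROVED, successor currency): frame + a quantitative landing dip ⇒ a successor at level `j+1` — by the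
QUANTITATIVE Jensen dip (`RhW08.Lens1Quant.succ_of_dip_edge`: zero removal + the sign lemma).  Deep or edge alike; no use of `v`'s
coordinates, of `DiscOverlap`, or of `¬ReadyR2`. -/
theorem regime_LQ {η : ℝ} {f : ℂ → ℂ} {x₀ s hmax R Hs : ℝ} {B j : ℕ} {v : ℂ}
    (hE : EngineHyps5 2 η f x₀ s hmax R Hs B) (h : LandingDipQ f x₀ R Hs j v) :
    ∃ u : ℂ, StTrkDQ η f x₀ s hmax R Hs B (j + 1) u := by
  obtain ⟨xs, m, A, -, hm, h2, hA, hmA, N, h, hN, hh, hNh, hwin⟩ := h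
  exact RhW08.Lens1Quant.succ_of_dip_edge hE hm h2 hA hmA hN hh hNh hwin

/-! ## §17 The residual stub «L-far» and the v3 compositions -/

/-- (v3) OPEN REGIME «L-far» in Q8-door currency: cell L with NEITHER a deep dip NOR a quantitative dip ⇒ a door.  (On TABLE S of the
census its population is expected to be 0; its content, if any, lives on wide-column / cubic-edge frames.)  Strictly weaker than `RegLedge8`
(`regLfar8_of_regLedge8`). -/
def RegLfar8 : Prop :=
  ∀ (η : ℝ) (f : ℂ → ℂ) (x₀ s hmax R Hs : ℝ) (B : ℕ), EngineHyps5 2 η f x₀ s hmax R Hs B → ∀ (j : ℕ) (v : ℂ),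
    IsLowest StTrkDQ η f x₀ s hmax R Hs B j v → ¬ ReadyR2 η f x₀ s hmax R Hs B j v →
    ¬ AllInBandInRangeWindow f x₀ R Hs j v → ¬ Dimple f j v → DiscOverlap f j v →
    iteratedDeriv (j + 1) f v ≠ 0 → CellL f x₀ R Hs j v → ¬ LandingDipDeep f x₀ R Hs j v → ¬ LandingDipQ f x₀ R Hs j v →
    Doors8 f x₀ R Hs j v

/-- Monotonicity: the L-edge stub implies the L-far stub. -/
theorem regLfar8_of_regLedge8 (hL : RegLedge8) : RegLfar8 :=
  fun η f x₀ s hmax R Hs B hE j v hlow hnR hwin hdim hov hz hc hnd _ =>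
    hL η f x₀ s hmax R Hs B hE j v hlow hnR hwin hdim hov hz hc hnd

/-- Monotonicity: the cell-L stub implies the L-far stub. -/
theorem regLfar8_of_regL8 (hL : RegL8) : RegLfar8 :=
  regLfar8_of_regLedge8 (regLedge8_of_regL8 hL)

/-- Monotonicity: the SUCC law of record implies the residual stub. -/
theorem regLfar8_of_doorAvailLawQ8 (hL8 : RhW08.LandingDoor.DoorAvailLawQ8) : RegLfar8 :=
  regLfar8_of_regL8 (doorAvailLawQ8_implies_regimes hL8).2.2.2.1

/-- ★ (v3) `AntiEscapeCore` from `RegCov8`, `RegLfar8`, `RegE8`: cells F, N♭, L-deep, L-Q are discharged by PROVED regime lemmas. -/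
theorem antiEscapeCore_of_regimes3 (hRB : RealCritBoundNSig) (hC : RegCov8) (hL : RegLfar8) (hX : RegE8) : AntiEscapeCore := by
  intro η f x₀ s hmax R Hs B hE j v hlow hnR hwin hdim hov
  by_cases hz : iteratedDeriv (j + 1) f v = 0
  · exact succ_of_multiple hE hlow.1 hz
  rcases cells_cover f x₀ R Hs j v with h | h | h | h | h
  · exact succ_of_doors8 hRB hE hlow hnR
      (hC η f x₀ s hmax R Hs B hE j v hlow hnR hwin hdim hov hz h (exists_cover_of_coverIndex_pos_frame hE hlow.1 hz h))
  · exact regime_F hE hlow.1 h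
  · exact regime_Nb hE hlow.1 h
  · by_cases hdeep : LandingDipDeep f x₀ R Hs j v
    · exact regime_Ldeep hE hdeep
    · by_cases hq : LandingDipQ f x₀ R Hs j v
      · exact regime_LQ hE hq
      · exact succ_of_doors8 hRB hE hlow hnR (hL η f x₀ s hmax R Hs B hE j v hlow hnR hwin hdim hov hz h hdeep hq)
  · exact succ_of_doors8 hRB hE hlow hnR (hX η f x₀ s hmax R Hs B hE j v hlow hnR hwin hdim hov hz h)

/-- `RestSuccBotQ` from `RegCov8`, `RegLfar8`, `RegE8`, via `antiEscapeCore_of_regimes3`. -/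
theorem restSuccBotQ_of_regimes3 (hRB : RealCritBoundNSig) (hC : RegCov8) (hL : RegLfar8) (hX : RegE8) : RestSuccBotQ :=
  restSuccBotQ_of_pieces dimpleSig_holds (antiEscape_of_core (antiEscapeCore_of_regimes3 hRB hC hL hX))

/-- ★★ (v3) THE CRUX BY NAME from `RegCov8`, `RegLfar8`, `RegE8` and lens-2's rate law (director's DRAFT-4 composition). -/
theorem TiltedLandingLaw421R_of_regimes3 (hC : RegCov8) (hL : RegLfar8) (hX : RegE8) (hR : RhW08.RateSplit.RateLawsHalfQ) :
    Summit.RiemannHypothesis.RiemannHypothesis.Theses.EarlyAppointments.TiltedLandingLaw421R :=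
  law421Half_of_succ_rate (restSuccBotQ_of_regimes3 RhW08.ClusterQM.realCritBoundNSig_holds hC hL hX)
    (RhW08.RateSplit.restRateBotPQ_half_of_rateLaws hR)

/-- Sanity (v7q/v8q ⇒ v3): the earlier compositions' hypotheses still close the crux through this file. -/
theorem TiltedLandingLaw421R_of_regimes2' (hC : RegCov8) (hL : RegLedge8) (hX : RegE8) (hR : RhW08.RateSplit.RateLawsHalfQ) :
    Summit.RiemannHypothesis.RiemannHypothesis.Theses.EarlyAppointments.TiltedLandingLaw421R :=
  TiltedLandingLaw421R_of_regimes3 hC (regLfar8_of_regLedge8 hL) hX hR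

end RhW08.Lens1Coverage
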